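import Literature.Geometry.Riemannian.RoundConeMap
import Literature.Geometry.Riemannian.ConeExitDerivative
import Literature.Geometry.Riemannian.SphereSecondFundamentalForm
import HarnessLib

/-!
# The exit inequality of the collar cone map of the round sphere, in coordinates

Topic `Geometry/Riemannian`. Continuing `RoundConeMap.lean`: the scalar exit inequality
`-λ f(1) ≤ ½ f'(1)`, `f(t) = G_U(Cf(tu))(D Cf_{tu}(tw), D Cf_{tu}(tw))`, for the coordinate cone
map `Cf` of the unit sphere of `(U, g_U)` (`ConeExitDerivative.neg_mul_val_le_half_deriv_coneMap`),
from the pointwise Christoffel bound `⟪p, Γ_p(X)(X)⟫ ≤ λ √q G_U(X, X)` on the sphere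
(`SphereSecondFundamentalForm.neg_mul_val_le_val_covariantDerivAlong_sphereNormal` supplies the
curve form of `II ≥ -λ`). This is hypothesis `hexit` of Weinstein's criterion for the disk of the
surgery, in the round model (Weinstein 1968, proof of the main theorem, steps (2)–(3)).

* `roundConeMap_exit`.

## References

* A. Weinstein, Ann. of Math. (2) 87 (1968), 29–41. [cite: Weinstein1968]

Tags: [ConeMap] [Sphere] [Weinstein1968]
-/

noncomputable section

open Bundle Set Function Filter TopologicalSpace Metric Module
open scoped Manifold ContDiff Topology RealInnerProductSpace

namespace Literature.Geometry.Riemannian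

open Literature.Geometry.Lorentzian
open Literature.Geometry.Lorentzian.OpensChart
open Literature.Geometry.Lorentzian.PseudoRiemannianMetric

variable {V : Type*} [NormedAddCommGroup V] [InnerProductSpace ℝ V] [FiniteDimensional ℝ V]
  {U : Opens V}
  (gU : PseudoRiemannianMetric 𝓘(ℝ, V) ∞ V (TangentSpace 𝓘(ℝ, V) : U → Type _)) [gU.HasLeviCivita]
  (GU : V → V →L[ℝ] V →L[ℝ] ℝ)

set_option maxHeartbeats 1600000 in
/-- **The exit inequality for the coordinate cone map.** With the Christoffel bound
`⟪p, Γ_p(X)(X)⟫ ≤ λ √q(p) G_U(p)(X, X)` on the unit sphere (`λ ≥ 0`), the coordinate cone map `Cf`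
satisfies, for every unit `u` and every `w`,
`-(λ G_U(Cf u)(D Cf_u w, D Cf_u w)) ≤ ½ d/dt|_{t=1} G_U(Cf(tu))(D Cf_{tu}(tw), D Cf_{tu}(tw))`.
[cite: Weinstein1968, proof of the main theorem, steps (2)–(3)] -/
theorem roundConeMap_exit {d : ℕ} (hdimE : finrank ℝ V = d + 1) (hG : ∀ y : U, gU.val y = GU y)
    (hgU : gU.IsRiemannian) (u₀ : U) (hSU : ∀ w : V, ‖w‖ = 1 → w ∈ U) {lam : ℝ} (hlam : 0 ≤ lam)
    (hΓ : ∀ p : U, ‖(p : V)‖ = 1 → ∀ X : V,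
      ⟪(p : V), christoffel gU GU p X X⟫ ≤
        lam * Real.sqrt (GU p ((GU p).inverse (innerSL ℝ (p : V))) ((GU p).inverse (innerSL ℝ (p : V)))) *
          GU p X X)
    (Cf : V → V) :
      (∀ v : V, Cf v = ((expMap gU.leviCivita ((extChartAt 𝓘(ℝ, V) u₀).symm (‖v‖⁻¹ • v))
        ((‖v‖ - 1) • ((Real.sqrt (GU (((extChartAt 𝓘(ℝ, V) u₀).symm (‖v‖⁻¹ • v) : U) : V) ((GU (((extChartAt 𝓘(ℝ, V) u₀).symm (‖v‖⁻¹ • v) : U) : V)).inverse (innerSL ℝ (((extChartAt 𝓘(ℝ, V) u₀).symm (‖v‖⁻¹ • v) : U) : V))) ((GU (((extChartAt 𝓘(ℝ, V) u₀).symm (‖v‖⁻¹ • v) : U) : V)).inverse (innerSL ℝ (((extChartAt 𝓘(ℝ, V) u₀).symm (‖v‖⁻¹ • v) : U) : V)))))⁻¹ • (GU (((extChartAt 𝓘(ℝ, V) u₀).symm (‖v‖⁻¹ • v) : U) : V)).inverse (innerSL ℝ (((extChartAt 𝓘(ℝ, V) u₀).symm (‖v‖⁻¹ • v) : U) : V))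 : TangentSpace 𝓘(ℝ, V) ((extChartAt 𝓘(ℝ, V) u₀).symm (‖v‖⁻¹ • v)))) : U) : V)) →
      ∀ u w : V, ‖u‖ = 1 →
        -(lam * GU (Cf u) (fderiv ℝ Cf u w) (fderiv ℝ Cf u w)) ≤
          (1 / 2) * deriv (fun t : ℝ ↦ GU (Cf (t • u)) (fderiv ℝ Cf (t • u) (t • w))
            (fderiv ℝ Cf (t • u) (t • w))) 1 := by
  haveI : Fact (finrank ℝ V = d + 1) := ⟨hdimE⟩
  haveI : CompleteSpace V := FiniteDimensional.complete ℝ V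
  haveI : CovariantDerivative.ContMDiffCovariantDerivative gU.leviCivita ∞ :=
    contMDiffCovariantDerivative_leviCivita_infty gU le_rfl
  haveI : CovariantDerivative.ContMDiffCovariantDerivative gU.leviCivita 1 :=
    ⟨gU.isLocallyContMDiff_leviCivita_holds 1 (by exact_mod_cast le_top) univ isOpen_univ⟩
  /- ── the hypersurface data ── -/
  set ι : V → U := fun v ↦ (extChartAt 𝓘(ℝ, V) u₀).symm (‖v‖⁻¹ • v) with hι
  set Nr : V → V := fun w ↦ (GU w).inverse (innerSL ℝ w) with hNr
  set νf : V → V := fun w ↦ (Real.sqrt (GU w (Nr w) (Nr w)))⁻¹ • Nr w with hνf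
  set ν : Π v : V, TangentSpace 𝓘(ℝ, V) (ι v) := fun v ↦ (νf ((ι v : U) : V) : TangentSpace 𝓘(ℝ, V) (ι v))
    with hν
  have hιv : ∀ v : V, v ≠ 0 → ((ι v : U) : V) = ‖v‖⁻¹ • v := fun v hv ↦
    coe_spherePresentation u₀ hSU hv
  have hιunit : ∀ u : V, ‖u‖ = 1 → ((ι u : U) : V) = u := fun u hu ↦ by
    have hu0 : u ≠ 0 := by intro h; rw [h, norm_zero] at hu; exact zero_ne_one hu
    rw [hιv u hu0, hu, inv_one, one_smul]
  have hs : ContMDiffOn 𝓘(ℝ, V) 𝓘(ℝ, V).tangent ∞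
      (fun v ↦ (TotalSpace.mk' V (ι v) (ν v) : TangentBundle 𝓘(ℝ, V) U)) {v : V | v ≠ 0} :=
    contMDiffOn_spherePresentation_normal gU GU hG hgU u₀ hSU
  have hhom : ∀ v : V, v ≠ 0 → ∀ t : ℝ, 0 < t →
      (TotalSpace.mk' V (ι (t • v)) (ν (t • v)) : TangentBundle 𝓘(ℝ, V) U) =
        TotalSpace.mk' V (ι v) (ν v) := fun v _ t ht ↦
    spherePresentation_normal_smul GU u₀ ht v
  have hunit : ∀ v : V, v ≠ 0 → gU.val (ι v) (ν v) (ν v) = 1 := by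
    intro v hv
    have hp : ((ι v : U) : V) ≠ 0 := by
      rw [hιv v hv]; exact smul_ne_zero (inv_ne_zero (norm_ne_zero_iff.2 hv)) hv
    exact val_sphereNormal_self gU GU hG hgU (ι v) hp
  have hperp : ∀ v : V, v ≠ 0 → ∀ z : V, gU.val (ι v) (mfderiv 𝓘(ℝ, V) 𝓘(ℝ, V) ι v z) (ν v) = 0 :=
    fun v hv z ↦ val_mfderiv_spherePresentation_normal gU GU hG u₀ hSU hv z
  have himm : ∀ v : V, v ≠ 0 → ∀ z : V, ⟪v, z⟫ = 0 → mfderiv 𝓘(ℝ, V) 𝓘(ℝ, V) ι v z = 0 → z = 0 :=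
    fun v hv z hz h0 ↦ mfderiv_spherePresentation_eq_zero u₀ hSU hv hz h0
  have hinj : ∀ v w : V, ‖v‖ = 1 → ‖w‖ = 1 → ι v = ι w → v = w :=
    fun v w hv hw h ↦ spherePresentation_injOn u₀ hSU hv hw h
  /- ── the collar of the cone map ── -/
  obtain ⟨ε₀, hε₀, hdom, -, -⟩ := exists_injOn_coneMap gU (ι := ι) (ν := ν) hs hhom hunit hperp
    himm hinj hdimE
  set ε : ℝ := min ε₀ (1 / 2) with hεdef
  have hε : 0 < ε := lt_min hε₀ (by norm_num)
  have hε1 : ε < 1 := (min_le_right _ _).trans_lt (by norm_num)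
  have hεε₀ : ε ≤ ε₀ := min_le_left _ _
  set A : Set V := {v : V | 1 - ε < ‖v‖ ∧ ‖v‖ < 1 + ε} with hA
  have hAo : IsOpen A :=
    (isOpen_lt continuous_const continuous_norm).inter (isOpen_lt continuous_norm continuous_const)
  have h0A : (0 : V) ∉ A := by
    intro h; have := h.1; rw [norm_zero] at this; linarith
  have hA0 : ∀ v ∈ A, v ≠ 0 := fun v hv h ↦ h0A (h ▸ hv)
  have hAI : ∀ v ∈ A, ‖v‖ - 1 ∈ Ioo (-ε₀) ε₀ := fun v hv ↦
    ⟨by linarith [hv.1], by linarith [hv.2]⟩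
  have hdomA : ∀ v ∈ A, (‖v‖ - 1) ∈ maximalGeodesicDomain gU.leviCivita (ι v) (ν v) :=
    fun v hv ↦ hdom v (hA0 v hv) _ (hAI v hv)
  have hdomεA : ∀ v ∈ A, ∀ t ∈ Ioo (-ε₀) ε₀, t ∈ maximalGeodesicDomain gU.leviCivita (ι v) (ν v) :=
    fun v hv t ht ↦ hdom v (hA0 v hv) t ht
  have hsA := hs.mono (fun v hv ↦ hA0 v hv)
  have hhomA : ∀ v ∈ A, ∀ t : ℝ, 0 < t →
      (TotalSpace.mk' V (ι (t • v)) (ν (t • v)) : TangentBundle 𝓘(ℝ, V) U) =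
        TotalSpace.mk' V (ι v) (ν v) := fun v hv t ht ↦ hhom v (hA0 v hv) t ht
  set CN : V → U := fun v ↦ expMap gU.leviCivita (ι v) ((‖v‖ - 1) • ν v) with hCN
  have hCNs : ContMDiffOn 𝓘(ℝ, V) 𝓘(ℝ, V) ∞ CN A := contMDiffOn_coneMap gU hAo h0A hsA hdomA
  intro hCf u w hu
  have hCfeq : Cf = (fun z : U ↦ (z : V)) ∘ CN := funext fun v ↦ hCf v
  have hfd : ∀ v ∈ A, ∀ z : V, fderiv ℝ Cf v z = (mfderiv 𝓘(ℝ, V) 𝓘(ℝ, V) CN v z : V) := by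
    intro v hv z
    have hCNd : MDifferentiableAt 𝓘(ℝ, V) 𝓘(ℝ, V) CN v :=
      ((hCNs v hv).contMDiffAt (hAo.mem_nhds hv)).mdifferentiableAt (by simp)
    have hvald : MDifferentiableAt 𝓘(ℝ, V) 𝓘(ℝ, V) (fun z : U ↦ (z : V)) (CN v) :=
      (contMDiff_subtype_val (n := ∞) (CN v)).mdifferentiableAt (by simp)
    rw [← mfderiv_eq_fderiv, hCfeq, mfderiv_comp v hvald hCNd]
    exact mfderiv_subtype_val_apply (CN v) (mfderiv 𝓘(ℝ, V) 𝓘(ℝ, V) CN v z)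
  have hGpt : ∀ v : V, ∀ a b : V, GU (Cf v) a b = gU.val (CN v) a b := by
    intro v a b
    rw [hCf v]
    exact (DFunLike.congr_fun (DFunLike.congr_fun (hG (CN v)) a) b).symm
  -- the curve form of `II ≥ -λ`
  have hII : ∀ γ : ℝ → V, ContDiff ℝ ∞ γ → (∀ s, ‖γ s‖ = 1) →
      -(lam * gU.val (ι (γ 0)) (velocity 𝓘(ℝ, V) (fun s ↦ ι (γ s)) 0)
        (velocity 𝓘(ℝ, V) (fun s ↦ ι (γ s)) 0)) ≤
        gU.val (ι (γ 0)) (covariantDerivAlong gU.leviCivita (fun s ↦ ι (γ s)) (fun s ↦ ν (γ s)) 0)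
          (velocity 𝓘(ℝ, V) (fun s ↦ ι (γ s)) 0) := fun γ hγs hγn ↦
    neg_mul_val_le_val_covariantDerivAlong_sphereNormal gU GU hG hgU u₀ hSU hΓ γ hγs hγn
  -- the exit inequality of the cone map in the manifold `U`
  have hex := neg_mul_val_le_half_deriv_coneMap gU (ι := ι) (ν := ν) hs hε₀
    (fun v hv t ht ↦ hdom v hv t ht) hhom hunit hperp hlam hII u w hu
  -- convert to coordinates
  have huA : u ∈ A := ⟨by rw [hu]; linarith, by rw [hu]; linarith⟩
  have h1u : ((1 : ℝ) • u) ∈ A := by rw [one_smul]; exact huA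
  have h1 : gU.val (CN ((1 : ℝ) • u)) (mfderiv 𝓘(ℝ, V) 𝓘(ℝ, V) CN ((1 : ℝ) • u) ((1 : ℝ) • w))
      (mfderiv 𝓘(ℝ, V) 𝓘(ℝ, V) CN ((1 : ℝ) • u) ((1 : ℝ) • w)) =
      GU (Cf u) (fderiv ℝ Cf u w) (fderiv ℝ Cf u w) := by
    rw [← hfd _ h1u, ← hGpt, one_smul, one_smul]
  have h2 : (fun t : ℝ ↦ gU.val (CN (t • u)) (mfderiv 𝓘(ℝ, V) 𝓘(ℝ, V) CN (t • u) (t • w))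
      (mfderiv 𝓘(ℝ, V) 𝓘(ℝ, V) CN (t • u) (t • w))) =ᶠ[𝓝 1]
      fun t : ℝ ↦ GU (Cf (t • u)) (fderiv ℝ Cf (t • u) (t • w)) (fderiv ℝ Cf (t • u) (t • w)) := by
    have hopen : IsOpen (Ioo (1 - ε) (1 + ε)) := isOpen_Ioo
    filter_upwards [hopen.mem_nhds (show (1 : ℝ) ∈ Ioo (1 - ε) (1 + ε) from ⟨by linarith, by linarith⟩)]
      with t ht
    have htpos : 0 < t := by linarith [ht.1]
    have htA : t • u ∈ A := by
      simp only [hA, mem_setOf_eq, norm_smul, Real.norm_eq_abs, abs_of_pos htpos, hu, mul_one]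
      exact ht
    rw [hGpt, hfd (t • u) htA]
  rw [h2.deriv_eq] at hex
  have hLHS : -(lam * GU (Cf u) (fderiv ℝ Cf u w) (fderiv ℝ Cf u w)) =
      -(lam * gU.val (CN ((1 : ℝ) • u)) (mfderiv 𝓘(ℝ, V) 𝓘(ℝ, V) CN ((1 : ℝ) • u) ((1 : ℝ) • w))
        (mfderiv 𝓘(ℝ, V) 𝓘(ℝ, V) CN ((1 : ℝ) • u) ((1 : ℝ) • w))) := by rw [h1]
  rw [hLHS]
  exact hex

end Literature.Geometry.Riemannian

end
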